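import Summits.CriticalPhenomena.CardyFormulaZ2.Theorems.CardySusyWardParafermionFamiliesToSLESixAnchoredWallFluxArm
import Literature.Probability.Percolation.IkhlefPonsaingFirstPassageVertex

/-!
# Touch lower bound on diagonal free walls (stub `stub_touchLowerBound`, reshape r2, of the line
# `exact-potential-schwarz-christoffel`, crux stmt-CriticalPhenomena-10814), A: the wall arm in general position

Helper file (pure lattice, plus the deterministic transfer to the completed configuration) for the LOCAL half
of `stub_touchLowerBound`: a site next to a flat DIAGONAL free wall is joined far away inside a thin band with
probability `≥ c · n^{-1/3}`, now UNCONDITIONALLY (Ikhlef–Ponsaing's strip law is the tree's theorem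
`IkhlefPonsaingFirstPassage_holds`) and in GENERAL POSITION:

* `exists_wallIso`: the four lattice automorphisms carrying a wall `{a v₀ + b v₁ = k}` (`a, b = ±1`) with the
  domain on the side `{a v₀ + b v₁ ≤ k}` to the standard wall `{hgtOf = 0}`, domain `{hgtOf ≥ 0}` of
  `S5.armStd_lower` (level flip `S5.exists_flipIso`, reflection `reflectIso 1`, translation `zdShiftIso`);
  `image_wallIso`: images of level/column sets;
* `armGen_lower`: `S5.armStd_lower` transported (`bondPercolation_real_image`): from a wall site `w₀` of level
  `k = a w₀ 0 + b w₀ 1` an open path descends `3n` levels inside the band `{|Δ(a v₀ - b v₁)| ≤ r}`, `32 r ≤ n`,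
  with probability `≥ c n^{-1/3}`;
* `reachable_bc_of_openConnIn`: an open lattice path inside a set of pairwise `Ω_δ`-adjacent sites off the arc `B`
  is a path of `E.bcBondConfig ω`;
* `wallArm_bc_lower`: the two combined — the form consumed by part C.
-/

noncomputable section

namespace Summit.CriticalPhenomena.CardyFormulaZ2.Theorems.ParafermionFamiliesToSLESix.TouchLowerBound

open MeasureTheory Set
open Literature.Probability.LatticeModels Literature.Probability.Percolation
open Literature.Probability.Percolation.TrackExchange (col hgtOf)
open Literature.Probability.Percolation.HalfPlaneArm (col_reflectIso_one hgtOf_reflectIso_one)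
open Summit.CriticalPhenomena.CardyFormulaZ2.Theorems.ParafermionFamiliesToSLESix.StripAnchored.S5 (exists_flipIso
  armStd_lower)

local notation3 "μ" => bondPercolation (zdGraph 2) half

/-! ## The four wall automorphisms -/

/-- **The wall automorphisms.** For signs `a, b = ±1` and a level `k` there is a lattice automorphism `Φ` with
`hgtOf (Φ v) = k - (a v₀ + b v₁)` and `col (Φ v) = C + ε (a v₀ - b v₁)` (`ε = ±1`): it carries the wall
`{a v₀ + b v₁ = k}` onto `{hgtOf = 0}` and the side `{a v₀ + b v₁ ≤ k}` onto `{hgtOf ≥ 0}`. [folklore] -/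
theorem exists_wallIso (a b k : ℤ) (ha : a = 1 ∨ a = -1) (hb : b = 1 ∨ b = -1) :
    ∃ (Φ : zdGraph 2 ≃g zdGraph 2) (C ε : ℤ), (ε = 1 ∨ ε = -1) ∧
      ∀ v : Site 2, hgtOf (Φ v) = k - (a * v 0 + b * v 1) ∧ col (Φ v) = C + ε * (a * v 0 - b * v 1) := by
  rcases ha with rfl | rfl <;> rcases hb with rfl | rfl
  · -- `(1, 1)`: the level flip
    obtain ⟨Φ, hΦ⟩ := exists_flipIso k
    refine ⟨Φ, k, 1, Or.inl rfl, fun v => ?_⟩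
    obtain ⟨h1, h2⟩ := hΦ v
    simp only [hgtOf, col]
    constructor <;> omega
  · -- `(1, -1)`: reflect, then flip
    obtain ⟨Φ, hΦ⟩ := exists_flipIso k
    refine ⟨Φ.comp (reflectIso (1 : Fin 2)), k, 1, Or.inl rfl, fun v => ?_⟩
    obtain ⟨h1, h2⟩ := hΦ (reflectIso (1 : Fin 2) v)
    have hc := col_reflectIso_one v
    have hh := hgtOf_reflectIso_one v
    simp only [hgtOf, col] at h1 h2 hc hh ⊢
    simp only [SimpleGraph.Iso.coe_comp, Function.comp_apply]
    constructor <;> omega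
  · -- `(-1, 1)`: reflect, then translate
    refine ⟨(zdShiftIso (Pi.single 0 k)).comp (reflectIso (1 : Fin 2)), k, -1, Or.inr rfl, fun v => ?_⟩
    have hc := col_reflectIso_one v
    have hh := hgtOf_reflectIso_one v
    simp only [hgtOf, col] at hc hh ⊢
    simp only [SimpleGraph.Iso.coe_comp, Function.comp_apply, zdShiftIso_apply, Pi.add_apply, Pi.single_eq_same,
      Pi.single_eq_of_ne (show (1 : Fin 2) ≠ 0 by decide), add_zero]
    constructor <;> omega
  · -- `(-1, -1)`: translate
    refine ⟨zdShiftIso (Pi.single 0 k), k, -1, Or.inr rfl, fun v => ?_⟩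
    simp only [hgtOf, col, zdShiftIso_apply, Pi.add_apply, Pi.single_eq_same,
      Pi.single_eq_of_ne (show (1 : Fin 2) ≠ 0 by decide), add_zero]
    constructor <;> ring

/-- Images under a wall automorphism of sets described by level `a v₀ + b v₁` and column `a v₀ - b v₁`. [folklore] -/
theorem image_wallIso (Φ : zdGraph 2 ≃g zdGraph 2) {k C ε : ℤ} {L T : Site 2 → ℤ} (hε : ε = 1 ∨ ε = -1)
    (hΦ : ∀ v : Site 2, hgtOf (Φ v) = k - L v ∧ col (Φ v) = C + ε * T v)
    (Q : ℤ → ℤ → Prop) {S : Set (Site 2)} (hS : ∀ v, v ∈ S ↔ Q (L v) (T v)) :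
    Φ '' S = {u : Site 2 | Q (k - hgtOf u) (ε * (col u - C))} := by
  ext u
  constructor
  · rintro ⟨v, hv, rfl⟩
    rw [hS] at hv
    obtain ⟨h1, h2⟩ := hΦ v
    have e1 : k - hgtOf (Φ v) = L v := by omega
    have e2 : ε * (col (Φ v) - C) = T v := by rcases hε with rfl | rfl <;> omega
    simp only [mem_setOf_eq]
    rw [e1, e2]
    exact hv
  · intro hu
    refine ⟨Φ.symm u, ?_, RelIso.apply_symm_apply Φ u⟩
    rw [hS]
    obtain ⟨h1, h2⟩ := hΦ (Φ.symm u)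
    rw [RelIso.apply_symm_apply] at h1 h2
    have e1 : L (Φ.symm u) = k - hgtOf u := by omega
    have e2 : T (Φ.symm u) = ε * (col u - C) := by rcases hε with rfl | rfl <;> omega
    rw [e1, e2]
    exact hu

/-! ## The wall arm in general position -/

/-- **The wall arm in general position** (`S5.armStd_lower`, made unconditional by
`IkhlefPonsaingFirstPassage_holds`, transported by `exists_wallIso`): there are `c > 0` and `L₀` such that for
`n ≥ L₀`, signs `a, b = ±1` and every site `w₀`, for some band half-width `r` with `32 r ≤ n`, with probability
`≥ c n^{-1/3}` an open lattice path joins `w₀` to the level `a w₀ 0 + b w₀ 1 - 3n` inside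
`{|a v₀ - b v₁ - (a w₀ 0 - b w₀ 1)| ≤ r, a w₀ 0 + b w₀ 1 - 3n ≤ a v₀ + b v₁ ≤ a w₀ 0 + b w₀ 1}`.
[cite: Nolin2008, §4.3, proof of Prop. 12 (i) (arXiv 0711.4948: Prop. 11), with §4.6] -/
theorem armGen_lower : ∃ c : ℝ, 0 < c ∧ ∃ L₀ : ℕ, ∀ n : ℕ, L₀ ≤ n →
    ∀ a b : ℤ, (a = 1 ∨ a = -1) → (b = 1 ∨ b = -1) → ∀ w₀ : Site 2, ∃ r : ℕ, 32 * r ≤ n ∧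
      c * (n : ℝ) ^ (-(1:ℝ) / 3) ≤ (μ).real (openCrossing
        {v : Site 2 | |(a * v 0 - b * v 1) - (a * w₀ 0 - b * w₀ 1)| ≤ r ∧
          a * w₀ 0 + b * w₀ 1 - 3 * n ≤ a * v 0 + b * v 1 ∧ a * v 0 + b * v 1 ≤ a * w₀ 0 + b * w₀ 1}
        {w₀} {v : Site 2 | a * v 0 + b * v 1 = a * w₀ 0 + b * w₀ 1 - 3 * n}) := by
  obtain ⟨c, hc, L₀, hP⟩ := armStd_lower IkhlefPonsaingFirstPassage_holds
  refine ⟨c, hc, max L₀ 1, fun n hn a b ha hb w₀ => ?_⟩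
  have hn₀ : L₀ ≤ n := le_trans (le_max_left _ _) hn
  have hn1 : 1 ≤ n := le_trans (le_max_right _ _) hn
  obtain ⟨Φ, C, ε, hε, hΦ⟩ := exists_wallIso a b (a * w₀ 0 + b * w₀ 1) ha hb
  have hw₀ : hgtOf (Φ w₀) = 0 := by have := (hΦ w₀).1; omega
  have hcw : col (Φ w₀) = C + ε * (a * w₀ 0 - b * w₀ 1) := (hΦ w₀).2
  obtain ⟨r, hr, hPr⟩ := hP n hn₀ (3 * n) (by omega) (by omega) (Φ w₀) hw₀
  refine ⟨r, hr, ?_⟩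
  have key := bondPercolation_real_image Φ half
    {v : Site 2 | |(a * v 0 - b * v 1) - (a * w₀ 0 - b * w₀ 1)| ≤ r ∧
      a * w₀ 0 + b * w₀ 1 - 3 * n ≤ a * v 0 + b * v 1 ∧ a * v 0 + b * v 1 ≤ a * w₀ 0 + b * w₀ 1}
    {w₀} {v : Site 2 | a * v 0 + b * v 1 = a * w₀ 0 + b * w₀ 1 - 3 * n}
  have e1 : Φ '' {v : Site 2 | |(a * v 0 - b * v 1) - (a * w₀ 0 - b * w₀ 1)| ≤ r ∧
      a * w₀ 0 + b * w₀ 1 - 3 * n ≤ a * v 0 + b * v 1 ∧ a * v 0 + b * v 1 ≤ a * w₀ 0 + b * w₀ 1} =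
      {u : Site 2 | |col u - col (Φ w₀)| ≤ r ∧ 0 ≤ hgtOf u ∧ hgtOf u ≤ 3 * n} := by
    refine (image_wallIso Φ hε hΦ (fun l t => |t - (a * w₀ 0 - b * w₀ 1)| ≤ r ∧
      a * w₀ 0 + b * w₀ 1 - 3 * n ≤ l ∧ l ≤ a * w₀ 0 + b * w₀ 1)
      (S := {v : Site 2 | |(a * v 0 - b * v 1) - (a * w₀ 0 - b * w₀ 1)| ≤ r ∧
        a * w₀ 0 + b * w₀ 1 - 3 * n ≤ a * v 0 + b * v 1 ∧ a * v 0 + b * v 1 ≤ a * w₀ 0 + b * w₀ 1})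
      (fun v => Iff.rfl)).trans ?_
    ext u
    simp only [mem_setOf_eq, abs_le, hcw]
    rcases hε with rfl | rfl <;> constructor <;> rintro ⟨⟨h1, h2⟩, h3, h4⟩ <;>
      exact ⟨⟨by omega, by omega⟩, by omega, by omega⟩
  have e3 : Φ '' {v : Site 2 | a * v 0 + b * v 1 = a * w₀ 0 + b * w₀ 1 - 3 * n} =
      {u : Site 2 | hgtOf u = 3 * n} := by
    refine (image_wallIso Φ hε hΦ (fun l _ => l = a * w₀ 0 + b * w₀ 1 - 3 * n)
      (S := {v : Site 2 | a * v 0 + b * v 1 = a * w₀ 0 + b * w₀ 1 - 3 * n}) (fun v => Iff.rfl)).trans ?_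
    ext u
    simp only [mem_setOf_eq]
    omega
  rw [e1, image_singleton, e3] at key
  rw [key] at hPr
  exact hPr

/-! ## Transfer to the completed configuration -/

/-- **An open lattice path inside a set of pairwise `Ω_δ`-adjacent sites off the arc `B` is a path of the
completed configuration `E.bcBondConfig ω`** (domain edges with no endpoint on `B` keep their state).
[folklore] -/
theorem reachable_bc_of_openConnIn {E : DiscreteDobrushin} {ω : BondConfig (Site 2)}
    (hω : ω ⊆ (zdGraph 2).edgeSet) {R : Set (Site 2)}
    (hadj : ∀ v ∈ R, ∀ u ∈ R, (zdGraph 2).Adj v u → (discreteDomainGraph E.Ω E.δ).Adj v u)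
    (hB : ∀ v ∈ R, v ∉ E.zdArcB) {x z : Site 2} (h : ω ∈ openConnIn R x z) :
    (SimpleGraph.fromEdgeSet (E.bcBondConfig ω)).Reachable x z := by
  obtain ⟨hxR, hzR, hr⟩ := h
  let φ : (openGraph ω).induce R →g SimpleGraph.fromEdgeSet (E.bcBondConfig ω) :=
    { toFun := fun v => v.1
      map_rel' := by
        intro u v huv
        rw [SimpleGraph.induce_adj, openGraph_adj] at huv
        obtain ⟨he, hne⟩ := huv
        rw [SimpleGraph.fromEdgeSet_adj, E.mem_bcBondConfig_iff]
        have hadj' : (zdGraph 2).Adj u.1 v.1 := (SimpleGraph.mem_edgeSet _).1 (hω he)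
        refine ⟨⟨(SimpleGraph.mem_edgeSet _).2 (hadj _ u.2 _ v.2 hadj'), Or.inr ⟨he, fun y hy => ?_⟩⟩, hne⟩
        rcases Sym2.mem_iff.1 hy with rfl | rfl
        exacts [hB _ u.2, hB _ v.2] }
  exact hr.map φ

/-- **The wall arm, completed-configuration form.** There are `c > 0` and `L₀` such that for `n ≥ L₀`, signs
`a, b = ±1`, Dobrushin data `E`, a set `R` of pairwise `Ω_δ`-adjacent sites off the arc `B` containing the band
`{32 |a v₀ - b v₁ - (a x 0 - b x 1)| ≤ n, a x 0 + b x 1 - 3n ≤ a v₀ + b v₁ ≤ a x 0 + b x 1}` of the site `x`: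
with probability `≥ c n^{-1/3}` the site `x` is joined by open edges of `E.bcBondConfig ω` to a site of level
`a x 0 + b x 1 - 3n`. [cite: Nolin2008, §4.3, proof of Prop. 12 (i) (arXiv 0711.4948: Prop. 11), with §4.6] -/
theorem wallArm_bc_lower : ∃ c : ℝ, 0 < c ∧ ∃ L₀ : ℕ, ∀ n : ℕ, L₀ ≤ n → ∀ a b : ℤ, (a = 1 ∨ a = -1) → (b = 1 ∨ b = -1) → ∀ (E : DiscreteDobrushin) (R : Set (Site 2)) (x : Site 2), {v : Site 2 | 32 * |(a * v 0 - b * v 1) - (a * x 0 - b * x 1)| ≤ n ∧ a * x 0 + b * x 1 - 3 * n ≤ a * v 0 + b * v 1 ∧ a * v 0 + b * v 1 ≤ a * x 0 + b * x 1} ⊆ R → (∀ v ∈ R, ∀ u ∈ R, (zdGraph 2).Adj v u → (discreteDomainGraph E.Ω E.δ).Adj v u) → (∀ v ∈ R, v ∉ E.zdArcB) → c * (n : ℝ) ^ (-(1:ℝ) / 3) ≤ (bondPercolation (zdGraph 2) half).real {ω | ∃ z : Site 2, a * z 0 + b * z 1 = a * x 0 + b * x 1 - 3 * n ∧ (SimpleGraph.fromEdgeSet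 (E.bcBondConfig ω)).Reachable x z} := by
  obtain ⟨c, hc, L₀, hP⟩ := armGen_lower
  refine ⟨c, hc, L₀, fun n hn a b ha hb E R x hR hadj hB => ?_⟩
  obtain ⟨r, hr, hPr⟩ := hP n hn a b ha hb x
  refine hPr.trans (ENNReal.toReal_mono (measure_ne_top _ _) (measure_mono_ae ?_))
  filter_upwards [ae_subset_edgeSet (zdGraph 2) half] with ω hω h
  obtain ⟨x', hx', z, hz, hconn⟩ := h
  rw [mem_singleton_iff] at hx'
  subst hx'
  refine ⟨z, hz, reachable_bc_of_openConnIn hω hadj hB (openConnIn_mono (fun v hv => hR ?_) _ _ hconn)⟩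
  obtain ⟨h1, h2, h3⟩ := hv
  exact ⟨by have := abs_nonneg ((a * v 0 - b * v 1) - (a * x' 0 - b * x' 1)); nlinarith, h2, h3⟩

end Summit.CriticalPhenomena.CardyFormulaZ2.Theorems.ParafermionFamiliesToSLESix.TouchLowerBound

end
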